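import Summits.FinalStateConjecture.FinalStateConjecture.Theses.ExactKerrEnds
import Summits.FinalStateConjecture.FinalStateConjecture.Theorems.ExactKerrEndsTameEscapeToKerrEndsChartKerrEnd
import Summits.FinalStateConjecture.FinalStateConjecture.Theorems.ExactKerrEndsTameEscapeToKerrEndsTameJunction
import HarnessLib

/-!
# Route `ExactKerrEnds`, crux `TameEscapeToKerrEnds` (stmt-FinalStateConjecture-18522): the crux from
# its two remaining stubs (line `matched-kerr-solution-map`, S3a/S3b discharged)

The registered skeleton `Cruxes/TameEscapeToKerrEnds/Lines/matched_kerr_solution_map.lean` proves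
`TameEscapeToKerrEnds` from four stubs S1 (matched exterior Kerr gluing with a smooth solution map),
S2 (non-positive mass parameter forces an exact Kerr end), S3a (chart-level exact Kerr end ⇒ exact
Kerr end) and S3b (the tame junction). S3a and S3b are LANDED (`chartKerrEnd`,
`ExactKerrEndsTameEscapeToKerrEndsChartKerrEnd.lean`; `tameJunction`,
`ExactKerrEndsTameEscapeToKerrEndsTameJunction.lean`), so the crux now follows from S1 and S2
alone; this file records that sorry-free, with S1 and S2 written out as hypotheses (S1 with the
skeleton's one-definition vocabulary `IsChartExactKerrBeyond` unfolded), in the shape a route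
`--split` of the crux into S1, S2 can cite as its glue.

* S1 `MatchedKerrGluingFamily` — Mao–Oh–Tao arXiv:2308.13031 Thm 1.3 + Lemma 5.5 /
  Corvino–Schoen 2006 Thm 4 / Chruściel–Delay 2003 Thm 8.1 run CHARGE-MATCHED along `R ↦ d(R·)`:
  a radius-indexed family `G R` of admissible data, `= d` off `e.far R`, exactly a spacelike Kerr
  leaf beyond chart radius `4R`, DR-flat on the same end with masses `m R → M`, jointly smooth in
  `(R, x)`, `e.wDist (G R) d → 0` (needs `M > 0`). Its `C^∞` dependence on `R` and the weighted
  `C² × C¹` sup convergence are NOT in print.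
* S2 `NonposMassKerrEnded` — spacetime positive mass theorem and its rigidity (EHLS 2016,
  Beig–Chruściel 1996, Huang–Lee 2020): `M ≤ 0` forces `M = 0` and a Minkowski hypersurface.
-/

set_option linter.dupNamespace false

noncomputable section

namespace Summit.FinalStateConjecture.FinalStateConjecture.Theorems.ExactKerrEnds

open scoped Manifold ContDiff Topology
open Set Filter Function TopologicalSpace Literature.Geometry.Lorentzian
open Summit.FinalStateConjecture.FinalStateConjecture.Theorems.SwallowTheDatum.ParametricKerrBurial
  (SmoothSectionsOn AgreeAt)

/-- **`TameEscapeToKerrEnds` from S1 (matched exterior Kerr gluing with a smooth solution map) and S2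
(non-positive mass parameter forces an exact Kerr end)**, the stubs S3a/S3b of line
`matched-kerr-solution-map` being landed (`chartKerrEnd`, `tameJunction`). Fix `X` and an
exceptional admissible `d` (not Kerr-ended). If the Kerr–Schild facts fail, every datum is vacuously
Kerr-ended. Otherwise read off the sole DR end `(e, M)` of `d`; `M ≤ 0` is impossible for an
exceptional datum (S2); for `M > 0`, S1 gives the receding matched-Kerr family, `chartKerrEnd` makes
its members Kerr-ended, and `tameJunction` turns it into the tame injective immersed witness curve.
[folklore] -/
theorem tameEscapeToKerrEnds_of_matchedKerrGluing_of_nonposMassKerrEnded :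
    (∀ (X : Type) [TopologicalSpace X] [ChartedSpace E3 X] [IsManifold (𝓡 3) ∞ X] [T2Space X]
      [SecondCountableTopology X] [ConnectedSpace X], ∀ [Kerr.Facts],
      ∀ d ∈ admissibleVacuumData X, ∀ (e : AFEnd X) (M : ℝ), e.IsSoleEnd → 0 < M →
        e.IsStronglyAsymptoticallyFlatDR d M →
        ∃ (Rstar : ℝ) (m : ℝ → ℝ) (G : ℝ → InitialDataSet (𝓡 3) X),
          e.R < Rstar ∧ ContinuousOn m (Ioi Rstar) ∧ Tendsto m atTop (𝓝 M) ∧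
          SmoothSectionsOn 𝓘(ℝ, ℝ) G {p : ℝ × X | Rstar < p.1} ∧
          (∀ R : ℝ, Rstar < R →
            G R ∈ admissibleVacuumData X ∧ (∀ x ∉ e.far R, AgreeAt (G R) d x) ∧
              e.IsStronglyAsymptoticallyFlatDR (G R) (m R) ∧
              ∃ (M' a r₀ : ℝ) (hM' : 0 ≤ M') (ψ : exteriorRegion (4 * R) → Kerr.region a r₀)
                (ν : NormalField 𝓘(ℝ, E4) ψ),
                Injective ψ ∧
                (Kerr.smoothMetric M' a r₀).IsSpacelikeImmersion 𝓘(ℝ, E3) ψ ∧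
                (Kerr.smoothMetric M' a r₀).IsFutureUnitNormal 𝓘(ℝ, E3)
                  ((Kerr.timeOrientation M' a r₀ hM').ofLE le_top) ψ ν ∧
                (∀ (y : exteriorRegion (4 * R)) (v w : E3),
                  AFEnd.hCoeff e (G R) (y : E3) v w =
                    Kerr.bilin M' a (ψ y : E4) (mfderiv 𝓘(ℝ, E3) 𝓘(ℝ, E4) ψ y v)
                      (mfderiv 𝓘(ℝ, E3) 𝓘(ℝ, E4) ψ y w)) ∧
                (∀ [(Kerr.smoothMetric M' a r₀).HasLeviCivita] (y : exteriorRegion (4 * R)) (v w : E3),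
                  AFEnd.kCoeff e (G R) (y : E3) v w =
                    (Kerr.smoothMetric M' a r₀).secondFundamentalForm 𝓘(ℝ, E3) ψ ν y v w)) ∧
          Tendsto (fun R ↦ e.wDist (G R) d) atTop (𝓝 0)) →
    (∀ (X : Type) [TopologicalSpace X] [ChartedSpace E3 X] [IsManifold (𝓡 3) ∞ X] [T2Space X]
      [SecondCountableTopology X] [ConnectedSpace X],
      ∀ d ∈ admissibleVacuumData X, ∀ (e : AFEnd X) (M : ℝ), e.IsSoleEnd → M ≤ 0 →
        e.IsStronglyAsymptoticallyFlatDR d M → d.HasExactKerrEnd) →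
    Summit.FinalStateConjecture.FinalStateConjecture.Theses.ExactKerrEnds.TameEscapeToKerrEnds := by
  intro h1 h2 X _ _ _ _ _ _
  -- the crux, with its let-bound legend `KerrEnded` zeta-reduced, is tame genericity of `HasExactKerrEnd`
  show InitialDataSet.IsTameChristodoulouGeneric (admissibleVacuumData X)
    (fun D : InitialDataSet (𝓡 3) X ↦ D.HasExactKerrEnd) 1
  intro d hd
  obtain ⟨hd𝓓, hdexc⟩ := hd
  by_cases hKF : Kerr.Facts
  · obtain ⟨-, e, M, hsole, hDR⟩ := id hd𝓓
    by_cases hM : 0 < M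
    · obtain ⟨Rstar, m, G, hRstar, hm, hmM, hG, hmem, hw⟩ := h1 X d hd𝓓 e M hsole hM hDR
      have hmem' : ∀ R : ℝ, Rstar < R →
          G R ∈ admissibleVacuumData X ∧ (∀ x ∉ e.far R, AgreeAt (G R) d x) ∧
            e.IsStronglyAsymptoticallyFlatDR (G R) (m R) ∧ (G R).HasExactKerrEnd := by
        intro R hR
        obtain ⟨hadm, hagree, hdecay, hkerr⟩ := hmem R hR
        refine ⟨hadm, hagree, hdecay, chartKerrEnd X e (G R) (4 * R) hsole ?_ hkerr⟩
        have hRpos : 0 < R := lt_trans e.R_pos (lt_trans hRstar hR)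
        linarith
      obtain ⟨e', F, htame, himm, hF0, hinj, hadm, hK⟩ :=
        tameJunction X d e M Rstar m G hd𝓓 hsole hDR hRstar hm hmM hG hmem' hw
      exact ⟨e', F, htame, himm, hF0, hinj, hadm, fun c hc hmem_exc ↦ hmem_exc.2 (hK c hc)⟩
    · have hK : d.HasExactKerrEnd := h2 X d hd𝓓 e M hsole (not_lt.mp hM) hDR
      exact (hdexc hK).elim
  · exact absurd (fun hinst ↦ absurd hinst hKF) hdexc

end Summit.FinalStateConjecture.FinalStateConjecture.Theorems.ExactKerrEnds

end
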